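import Summits.ABC.ABC.Theorems.PrimePowerRadical.Negative.WieferichSparse
import Summits.ABC.ABC.Theorems.PrimePowerRadical.Negative.Orders

/-!
# Stub `stub_level2_iff_sqDivisorBound`: calibration of the level-2 bet of line `nevbir-below-beta` (crux stmt-ABC-1648 `PrimePowerRadical`)

This file does NOT prove the level-2 bet `stub_level2_beyondLiouville` (it is a rung of the Wieferich level ladder, open at
every prime base). It proves the registered CALIBRATION stub `stub_level2_iff_sqDivisorBound` of the lead's skeleton
(`Cruxes/PrimePowerRadical/Lines/nevbir_below_beta.lean`), the Lean certificate of the stub worker's loophole audit: the typed level-2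
"beyond Liouville" statement at a prime `q` (exceptional curve `F = 1`, skeleton defs `towerG`/`TowerIneq`
unfolded) is EQUIVALENT to a square-divisor bound with some exponent `μ < 1/2`,

  `∃ μ ∈ [0, 1/2), ∃ C, ∀ k ≥ 1, ∀ u, u² ∣ q^k − 1 → u ≤ C · q^{μk}`          (`stub_level2_iff_sqDivisorBound`).

* Forward (`lvl2_sqDivisorBound_of_level2`, adapted from the skeleton's `sqDivisorBound_of_level2`, no
  Siegel–Mahler input since `F = 1`): at a square divisor both exceptional sums equal `log u`
  (`lvl2_sum_of_sq_dvd`), and the inequality rearranges to `D · log u ≤ θ₀ · k log q + C` with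
  `θ₀ = 1 + ε − 2b_H − b_Y ≥ 0`, `D = (1+ε)(c₀+c₁) − b_Y > 2θ₀` (the margin), so `μ = θ₀/D < 1/2`.
* Converse (`lvl2_level2_of_sqDivisorBound`): given the bound with `μ < 1/2`, the tuple
  `(c₀, c₁, b_H, b_Y, ε) = (0, 1/μ', 0, 0, 0)`, `μ' = max(μ, 1/4)`, is admissible (`2 − 1/μ' < 0`) and its
  inequality reads `G₂(u) ≤ μ'·k log q + O(1)`, where `G₂(u) = Σ_p min(v_p − j_p, j_p) log p = log d(u)` for the
  gcd-part `d(u) = ∏ p^{min(v_p − j_p, j_p)}`, a square divisor of `q^k − 1` (`lvl2_gcdPart_sq_dvd`,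
  `lvl2_log_gcdPart`); the bound applied to `d(u)` gives it.

Hence no admissible parameter tuple makes the stub trivial: every one yields an exponential saving on square
divisors of `q^k − 1`, which via `stub_PPRAt_of_sqDivisorBound` and `Negative.infinite_level_le_of_PPRAt` is a
rung of the level ladder. Sources: the line skeleton `Cruxes/PrimePowerRadical/Lines/nevbir_below_beta.lean`;
BarrierNotes-r1-k2 B1; Disproof.lean §13.
-/

noncomputable section

-- `Summit.<Summit>.<Problem>` is the mandated summit-side namespace (CONVENTIONS §2); for the
-- single-conjunct summit `ABC` the two coincide, so the duplicate `ABC.ABC` is deliberate.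
set_option linter.dupNamespace false

namespace Summit.ABC.ABC.Theorems.PrimePowerRadical.NevbirBelowBeta

open Literature.NumberTheory.DiophantineGeometry UniqueFactorizationMonoid
open Summit.ABC.ABC.Theses.IneffectiveSubspace
open Summit.ABC.ABC.Theorems.PrimePowerRadical.Negative

/-! ## Level-2 bookkeeping: the two exceptional sums at a square divisor, and the gcd-part -/

/-- At a square divisor `u² ∣ m ≠ 0` both level-2 exceptional sums equal `log u`:
`Σ_p (c₀·min(v_p, j_p) + c₁·min(v_p − j_p, j_p)) log p = (c₀ + c₁) · log u`. -/
theorem lvl2_sum_of_sq_dvd {m u : ℕ} (hm : m ≠ 0) (hu : u ^ 2 ∣ m) (c : ℕ → ℝ) :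
    ∑ p ∈ m.primeFactors, (∑ i ∈ Finset.range 2, c i *
        ((min (m.factorization p - i * u.factorization p) (u.factorization p) : ℕ) : ℝ)) * Real.log p
      = (c 0 + c 1) * Real.log u := by
  -- adapted from `Summit.ABC.ABC.Cruxes.PrimePowerRadical.NevbirBelowBeta.towerG_two_of_sq_dvd`
  have hu0 : u ≠ 0 := by
    rintro rfl
    exact hm (by simpa using hu)
  have hdvd : u ∣ m := (dvd_pow_self u two_ne_zero).trans hu
  have hv : ∀ p : ℕ, 2 * u.factorization p ≤ m.factorization p := by
    intro p
    have h2 := (Nat.factorization_le_iff_dvd (pow_ne_zero 2 hu0) hm).mpr hu p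
    simpa [Nat.factorization_pow] using h2
  have hlog : Real.log u = ∑ p ∈ u.primeFactors, (u.factorization p : ℝ) * Real.log p := by
    rw [Real.log_nat_eq_sum_factorization, Finsupp.sum, Nat.support_factorization]
  have hsub : u.primeFactors ⊆ m.primeFactors := Nat.primeFactors_mono hdvd hm
  rw [hlog, Finset.mul_sum]
  rw [Finset.sum_subset hsub (fun p _ hpu => by
    have h0 : u.factorization p = 0 := by
      rw [← Finsupp.notMem_support_iff, Nat.support_factorization]
      exact hpu
    simp [h0])]
  refine Finset.sum_congr rfl fun p _ => ?_
  have h2 := hv p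
  have e1 : min (m.factorization p - 0 * u.factorization p) (u.factorization p) = u.factorization p := by
    rw [zero_mul, tsub_zero]; exact min_eq_right (by omega)
  have e2 : min (m.factorization p - 1 * u.factorization p) (u.factorization p) = u.factorization p := by
    rw [one_mul]; exact min_eq_right (by omega)
  simp only [Finset.sum_range_succ, Finset.sum_range_zero, zero_add, e1, e2]
  ring

/-- The gcd-part `d(u) = ∏_{p ∣ m} p^{min(v_p(m) − v_p(u), v_p(u))}` (= `gcd(u, m/u)` for `u ∣ m`) is a square
divisor of `m`: `2·min(v − j, j) ≤ v`. -/
theorem lvl2_gcdPart_sq_dvd {m : ℕ} (hm : m ≠ 0) (u : ℕ) :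
    (∏ p ∈ m.primeFactors, p ^ min (m.factorization p - u.factorization p) (u.factorization p)) ^ 2 ∣ m := by
  rw [← Finset.prod_pow]
  simp_rw [← pow_mul]
  refine prod_prime_pow_dvd_of_forall_dvd (fun r hr => Nat.prime_of_mem_primeFactors hr)
    (fun r => min (m.factorization r - u.factorization r) (u.factorization r) * 2) hm fun r _ => ?_
  exact (pow_dvd_pow r (by omega)).trans (Nat.ordProj_dvd m r)

/-- The logarithm of the gcd-part is the second exceptional sum `G₂(u) = Σ_p min(v_p − j_p, j_p) · log p`. -/
theorem lvl2_log_gcdPart (m u : ℕ) :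
    Real.log ((∏ p ∈ m.primeFactors, p ^ min (m.factorization p - u.factorization p) (u.factorization p) : ℕ) : ℝ)
      = ∑ p ∈ m.primeFactors,
          ((min (m.factorization p - u.factorization p) (u.factorization p) : ℕ) : ℝ) * Real.log p := by
  rw [Nat.cast_prod, Real.log_prod fun p hp => ?_]
  · refine Finset.sum_congr rfl fun p _ => ?_
    rw [Nat.cast_pow, Real.log_pow]
  · exact_mod_cast pow_ne_zero _ (Nat.prime_of_mem_primeFactors hp).ne_zero

/-! ## Forward: an admissible level-2 inequality gives a square-divisor exponent `μ = θ₀/D < 1/2` -/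

/-- **Forward direction.** If the level-2 weighted inequality holds at the family points (`F = 1`) with
`θ₀ = 1 + ε − 2b_H − b_Y ≥ 0` and the beyond-Liouville margin `(1+ε)(2 − c₀ − c₁) < 4b_H + b_Y`, then every
square divisor `u² ∣ q^k − 1` satisfies `u ≤ C · q^{μk}` with `μ = θ₀ / ((1+ε)(c₀+c₁) − b_Y)` (`< 1/2`). -/
theorem lvl2_sqDivisorBound_of_level2 {q : ℕ} (hq : q.Prime) {c : ℕ → ℝ} {bH bY ε : ℝ}
    (hθ0 : 0 ≤ 1 + ε - 2 * bH - bY) (hmargin : (1 + ε) * (2 - c 0 - c 1) < 4 * bH + bY)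
    (hineq : ∃ C : ℝ, ∀ k : ℕ, 1 ≤ k → ∀ u : ℕ, u ∣ q ^ k - 1 →
        MvPolynomial.eval ![((q : ℤ) ^ k), (u : ℤ)] (1 : MvPolynomial (Fin 2) ℤ) ≠ 0 →
          bH * (2 * ((k : ℝ) * Real.log q)) + bY * ((k : ℝ) * Real.log q - Real.log u)
            ≤ (1 + ε) * ((k : ℝ) * Real.log q -
                ∑ p ∈ (q ^ k - 1).primeFactors,
                  (∑ i ∈ Finset.range 2, c i *
                    ((min ((q ^ k - 1).factorization p - i * u.factorization p) (u.factorization p) : ℕ) : ℝ))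
                  * Real.log p) + C) :
    ∃ C : ℝ, ∀ k : ℕ, 1 ≤ k → ∀ u : ℕ, u ^ 2 ∣ q ^ k - 1 →
      (u : ℝ) ≤ C * (q : ℝ) ^ ((1 + ε - 2 * bH - bY) / ((1 + ε) * (c 0 + c 1) - bY) * k) := by
  -- adapted from `Summit.ABC.ABC.Cruxes.PrimePowerRadical.NevbirBelowBeta.sqDivisorBound_of_level2`
  obtain ⟨C₁, hineq⟩ := hineq
  have hD0 : 0 < (1 + ε) * (c 0 + c 1) - bY := by linarith
  set θ₀ : ℝ := 1 + ε - 2 * bH - bY with hθ₀def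
  set D : ℝ := (1 + ε) * (c 0 + c 1) - bY with hDdef
  have hq0 : (0 : ℝ) < q := by exact_mod_cast hq.pos
  refine ⟨Real.exp (C₁ / D), fun k hk u hu => ?_⟩
  have hm0 : q ^ k - 1 ≠ 0 := by have := two_le_pow hq.two_le hk; omega
  have hdvd : u ∣ q ^ k - 1 := (dvd_pow_self u two_ne_zero).trans hu
  have h1 : MvPolynomial.eval ![((q : ℤ) ^ k), (u : ℤ)] (1 : MvPolynomial (Fin 2) ℤ) ≠ 0 := by
    rw [map_one]; exact one_ne_zero
  have hI := hineq k hk u hdvd h1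
  rw [lvl2_sum_of_sq_dvd hm0 hu c] at hI
  have hu0 : u ≠ 0 := by
    rintro rfl
    exact hm0 (by simpa using hu)
  have hu0' : (0 : ℝ) < u := by exact_mod_cast Nat.pos_of_ne_zero hu0
  have hlogu : D * Real.log u ≤ θ₀ * ((k : ℝ) * Real.log q) + C₁ := by
    rw [hDdef, hθ₀def]; linarith
  have hlogu' : Real.log u ≤ θ₀ / D * ((k : ℝ) * Real.log q) + C₁ / D := by
    rw [div_mul_eq_mul_div, ← add_div, le_div_iff₀ hD0]; linarith
  calc (u : ℝ) = Real.exp (Real.log u) := (Real.exp_log hu0').symm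
    _ ≤ Real.exp (θ₀ / D * ((k : ℝ) * Real.log q) + C₁ / D) := Real.exp_le_exp.mpr hlogu'
    _ = Real.exp (C₁ / D) * (q : ℝ) ^ (θ₀ / D * k) := by
        rw [Real.exp_add, Real.rpow_def_of_pos hq0, mul_comm (Real.exp _)]
        congr 1; ring_nf

/-! ## Converse: a square-divisor exponent `μ < 1/2` gives an admissible level-2 inequality -/

/-- **Converse direction.** A square-divisor bound `u² ∣ q^k − 1 ⟹ u ≤ C·q^{μk}` with `μ < 1/2` yields the
typed level-2 statement, with the admissible tuple `c i = i/μ'` (`c₀ = 0`, `c₁ = 1/μ'`), `b_H = b_Y = ε = 0`,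
`μ' = max(μ, 1/4)`: its inequality is `(1/μ')·log d(u) ≤ k log q + O(1)` for the gcd-part `d(u)`, `d(u)² ∣ q^k − 1`. -/
theorem lvl2_level2_of_sqDivisorBound {q : ℕ} (hq : q.Prime) {μ : ℝ} (hμ : μ < 1 / 2)
    (h : ∃ C : ℝ, ∀ k : ℕ, 1 ≤ k → ∀ u : ℕ, u ^ 2 ∣ q ^ k - 1 → (u : ℝ) ≤ C * (q : ℝ) ^ (μ * k)) :
    ∃ (c : ℕ → ℝ) (bH bY ε : ℝ),
      0 ≤ bH ∧ 0 ≤ bY ∧ 0 ≤ ε ∧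
      0 ≤ 1 + ε - 2 * bH - bY ∧
      (1 + ε) * (2 - c 0 - c 1) < 4 * bH + bY ∧
      ∃ C : ℝ, ∀ k : ℕ, 1 ≤ k → ∀ u : ℕ, u ∣ q ^ k - 1 →
        MvPolynomial.eval ![((q : ℤ) ^ k), (u : ℤ)] (1 : MvPolynomial (Fin 2) ℤ) ≠ 0 →
          bH * (2 * ((k : ℝ) * Real.log q)) + bY * ((k : ℝ) * Real.log q - Real.log u)
            ≤ (1 + ε) * ((k : ℝ) * Real.log q -
                ∑ p ∈ (q ^ k - 1).primeFactors,
                  (∑ i ∈ Finset.range 2, c i *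
                    ((min ((q ^ k - 1).factorization p - i * u.factorization p) (u.factorization p) : ℕ) : ℝ))
                  * Real.log p) + C := by
  obtain ⟨C, hC⟩ := h
  set μ' : ℝ := max μ (1 / 4) with hμ'def
  have hμ'0 : 0 < μ' := lt_max_of_lt_right (by norm_num)
  have hμ'2 : μ' < 1 / 2 := max_lt hμ (by norm_num)
  have hμμ' : μ ≤ μ' := le_max_left _ _
  set C₁ : ℝ := max C 1 with hC₁def
  have hC₁0 : 0 < C₁ := lt_max_of_lt_right one_pos
  have hq0 : (0 : ℝ) < q := by exact_mod_cast hq.pos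
  have hq1 : (1 : ℝ) < q := by exact_mod_cast hq.one_lt
  have hlogq : 0 ≤ Real.log q := Real.log_nonneg hq1.le
  have h2 : 2 < 1 / μ' := by rw [lt_div_iff₀ hμ'0]; linarith
  refine ⟨fun i => (i : ℝ) / μ', 0, 0, 0, le_rfl, le_rfl, le_rfl, by norm_num, ?_, Real.log C₁ / μ', ?_⟩
  · simp only [Nat.cast_zero, Nat.cast_one, zero_div]
    linarith
  intro k hk u _ _
  have hm0 : q ^ k - 1 ≠ 0 := by have := two_le_pow hq.two_le hk; omega
  -- the gcd-part `d = d(u)`: a square divisor of `q^k − 1` whose logarithm is `G₂(u)`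
  obtain ⟨d, hdm, hlogdsum⟩ : ∃ d : ℕ, d ^ 2 ∣ q ^ k - 1 ∧
      Real.log d = ∑ p ∈ (q ^ k - 1).primeFactors,
        ((min ((q ^ k - 1).factorization p - u.factorization p) (u.factorization p) : ℕ) : ℝ) * Real.log p :=
    ⟨_, lvl2_gcdPart_sq_dvd hm0 u, lvl2_log_gcdPart _ u⟩
  have hd0 : (0 : ℝ) < d := by
    have : d ≠ 0 := by
      rintro rfl
      exact hm0 (by simpa using hdm)
    exact_mod_cast Nat.pos_of_ne_zero this
  have hdle : (d : ℝ) ≤ C₁ * (q : ℝ) ^ (μ * k) :=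
    (hC k hk d hdm).trans (mul_le_mul_of_nonneg_right (le_max_left _ _) (Real.rpow_nonneg hq0.le _))
  have hlogd : Real.log d ≤ Real.log C₁ + μ * k * Real.log q := by
    have h1 := Real.log_le_log hd0 hdle
    rwa [Real.log_mul hC₁0.ne' (Real.rpow_pos_of_pos hq0 _).ne', Real.log_rpow hq0] at h1
  have hlogd' : Real.log d ≤ Real.log C₁ + μ' * ((k : ℝ) * Real.log q) := by
    have : μ * k * Real.log q ≤ μ' * ((k : ℝ) * Real.log q) := by
      rw [mul_assoc]; exact mul_le_mul_of_nonneg_right hμμ' (mul_nonneg (Nat.cast_nonneg k) hlogq)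
    linarith
  -- the level-2 sum for `c = (0, 1/μ')` is `(1/μ') · log d`
  have hsum : ∑ p ∈ (q ^ k - 1).primeFactors, (∑ i ∈ Finset.range 2, ((i : ℝ) / μ') *
      ((min ((q ^ k - 1).factorization p - i * u.factorization p) (u.factorization p) : ℕ) : ℝ)) * Real.log p
      = 1 / μ' * Real.log d := by
    rw [hlogdsum, Finset.mul_sum]
    refine Finset.sum_congr rfl fun p _ => ?_
    simp only [Finset.sum_range_succ, Finset.sum_range_zero, zero_add, Nat.cast_zero, Nat.cast_one,
      zero_div, zero_mul, one_mul]
    ring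
  have key : 1 / μ' * Real.log d ≤ (k : ℝ) * Real.log q + Real.log C₁ / μ' := by
    have e1 : (k : ℝ) * Real.log q + Real.log C₁ / μ' = 1 / μ' * (Real.log C₁ + μ' * ((k : ℝ) * Real.log q)) := by
      field_simp
      ring
    rw [e1]
    exact mul_le_mul_of_nonneg_left hlogd' (by positivity)
  rw [hsum]
  linarith

/-! ## The equivalence -/

/-- **Calibration of the level-2 bet.** For a prime `q`, the typed statement of `stub_level2_beyondLiouville`
(exceptional curve `F = 1`) holds iff `q^k − 1` has a square-divisor exponent `μ < 1/2`:
`∃ 0 ≤ μ < 1/2, ∃ C, ∀ k ≥ 1, u² ∣ q^k − 1 → u ≤ C·q^{μk}`. In particular no admissible parameter tuple is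
trivial: each yields `μ = (1+ε−2b_H−b_Y)/((1+ε)(c₀+c₁) − b_Y) < 1/2`, an exponential saving over Liouville's `μ = 1/2`. -/
theorem stub_level2_iff_sqDivisorBound {q : ℕ} (hq : q.Prime) :
    (∃ (c : ℕ → ℝ) (bH bY ε : ℝ),
      0 ≤ bH ∧ 0 ≤ bY ∧ 0 ≤ ε ∧
      0 ≤ 1 + ε - 2 * bH - bY ∧
      (1 + ε) * (2 - c 0 - c 1) < 4 * bH + bY ∧
      ∃ C : ℝ, ∀ k : ℕ, 1 ≤ k → ∀ u : ℕ, u ∣ q ^ k - 1 →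
        MvPolynomial.eval ![((q : ℤ) ^ k), (u : ℤ)] (1 : MvPolynomial (Fin 2) ℤ) ≠ 0 →
          bH * (2 * ((k : ℝ) * Real.log q)) + bY * ((k : ℝ) * Real.log q - Real.log u)
            ≤ (1 + ε) * ((k : ℝ) * Real.log q -
                ∑ p ∈ (q ^ k - 1).primeFactors,
                  (∑ i ∈ Finset.range 2, c i *
                    ((min ((q ^ k - 1).factorization p - i * u.factorization p) (u.factorization p) : ℕ) : ℝ))
                  * Real.log p) + C) ↔
    ∃ μ : ℝ, 0 ≤ μ ∧ μ < 1 / 2 ∧ ∃ C : ℝ, ∀ k : ℕ, 1 ≤ k → ∀ u : ℕ, u ^ 2 ∣ q ^ k - 1 →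
      (u : ℝ) ≤ C * (q : ℝ) ^ (μ * k) := by
  constructor
  · rintro ⟨c, bH, bY, ε, -, -, -, hθ0, hmargin, hineq⟩
    have hD0 : 0 < (1 + ε) * (c 0 + c 1) - bY := by linarith
    exact ⟨(1 + ε - 2 * bH - bY) / ((1 + ε) * (c 0 + c 1) - bY), div_nonneg hθ0 hD0.le,
      by rw [div_lt_iff₀ hD0]; linarith, lvl2_sqDivisorBound_of_level2 hq hθ0 hmargin hineq⟩
  · rintro ⟨μ, -, hμ, h⟩
    exact lvl2_level2_of_sqDivisorBound hq hμ h

end Summit.ABC.ABC.Theorems.PrimePowerRadical.NevbirBelowBeta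

end
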